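import Literature.Computability.AlgebraicComplexity.BorderRankExtensionTorus
import Literature.Computability.AlgebraicComplexity.BorderRankExtensionSieveForced
import Literature.Computability.AlgebraicComplexity.JelisiejewLandsbergPal2023MinimalBorderRank
import HarnessLib

/-!
# The extension sieve, V: weight-class certificates (spine of the torus-tree replay)

Topic `Literature/Computability/AlgebraicComplexity`.  Definitions (a decidable certificate format)
plus their soundness theorem; nothing is specific to one tensor.  HONEST FRAMING: the value is
DECIDABLE VERDICTS / CERTIFICATES about explicit small tensors, not progress on the exponent of
matrix multiplication.

`BorderRankExtensionTorus.lean` proves: if the integer tensor `T ∈ K^{a × b × c}` is homogeneous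
for coordinate weights `ωA, ωB, ωC ∈ ℕ`, `a < r ≤ bR(T)`, and EVERY new slice `Z ∉ T(A^*)` that is
homogeneous of some pair weight `m` (`Z_{jl} ≠ 0 ⇒ ωB j + ωC l = m`) gives `bR(T + e_new ⊗ Z) > r`,
then `bR(T) > r` (`lt_algBorderRank_of_card_lt_of_forall_weight_extendSlice`).  The weight classes
are finitely many, and this file is the bookkeeping that discharges the easy ones by a kernel
computation and leaves the others as named hypotheses:

* a class of weight `m` with `k_m := dim W_m / (T(A^*) ∩ W_m) = 0` (`W_m` = the matrices supported on
  the pairs of weight `m`): every homogeneous `Z` of weight `m` lies in `T(A^*)` — vacuous;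
  certificate (`K0Rec`): for every pair `(j,l)` of weight `m`, integer coefficients with
  `D · E_{jl} = ∑_i C_{jl,i} · (T_i)^{(m)}` (`(T_i)^{(m)}` = weight-`m` part of the slice `T_i`, which
  lies in `T(A^*)` because `T(A^*)` is graded, `weightPart_mem_sliceSpan`);
* a class with `k_m = 1`: every homogeneous `Z ∉ T(A^*)` of weight `m` is `λ z + v`, `λ ≠ 0`,
  `v ∈ T(A^*)`, for ONE integer representative `z`, so `bR(T + e_new ⊗ Z) = bR(T + e_new ⊗ z)`
  (`lt_algBorderRank_extendSlice_of_eq_smul_add`) and the class reduces to the single CHILD tensor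
  `T + e_new ⊗ z` (`SieveCert.extendInt T z`, an integer tensor of format `(a+1) × b × c`, refuted by
  its own certificate); certificate (`K1Rec`): `z` supported on weight `m` and
  `D · E_{jl} = ∑_i C_{jl,i} · (T_i)^{(m)} + L_{jl} · z` for every pair `(j,l)` of weight `m`;
* any other class (`k_m ≥ 2`) is listed as OPEN and its refutation
  `∀ Z homogeneous of weight m, Z ∉ T(A^*) → bR(T + e_new ⊗ Z) > r` stays a hypothesis of the
  soundness theorem (to be discharged by class-restricted sieve certificates).

`TorusCert.check` verifies homogeneity of `T`, that every pair weight is covered by a record, and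
the identities; `TorusCert.lt_algBorderRank_of_check` concludes `r < bR(T ⊗ K)` over every field
with `(D : K) ≠ 0` from the child bounds and the open-class hypotheses.  This is the node step of the
torus-fixed-point refutation trees of the numerics bundle (`tight4/trees/*.torus-r6.tree.json`,
node kind `factor`, weight kinds `k1` / `macaulay` / `points`).

## References

* J. Jagiełła, J. Jelisiejew, *Concise secant varieties and unrestrictions* (2026),
  arXiv:2604.24879 — Thm. 1.8 (fixed unrestriction theorem), Thm. 2.2.
  [JagiellaJelisiejew2026Unrestrictions]
* J. M. Landsberg, M. Michałek, IMRN 2018, arXiv:1608.07486 — Lemma 2.2. [LandsbergMichalek2018]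
* M. Bläser, *Fast Matrix Multiplication*, Theory of Computing Graduate Surveys 5 (2013), Def. 6.1.
  [Blaser2013]
-/

open scoped BigOperators

namespace Literature.Computability.AlgebraicComplexity

universe u

namespace TorusCert

open KYCert SieveCert
open JLPCert (finCode_of_lt)

/-! ### The certificate format -/

/-- Entry `i` of a list of naturals, default `0`. [folklore] -/
def nget (L : List ℕ) (i : ℕ) : ℕ := L.getD i 0

/-- Entry `(j, l, i)` of a triple list of integers, default `0`. [folklore] -/
def mget3 (C : List (List (List ℤ))) (j l i : ℕ) : ℤ := ((C.getD j []).getD l []).getD i 0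

/-- The pair weight `ωB j + ωC l`. [folklore] -/
def wt (wB wC : List ℕ) (j l : ℕ) : ℕ := nget wB j + nget wC l

/-- Certificate for a weight class with `k = 0`: weight `m` and, per pair `(j,l)`, coefficients
`C[j][l][i]` over the slices. [folklore] -/
structure K0Rec where
  /-- the pair weight of the class -/
  m : ℕ
  /-- `C[j][l]` = coefficients of `D · E_{jl}` over the weight-`m` parts of the slices -/
  C : List (List (List ℤ))

/-- Certificate for a weight class with `k = 1`: weight `m`, the representative `z` (integer
`b × c` row lists, supported on weight `m`), and per pair `(j,l)` coefficients `C[j][l][i]` over the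
slices and `L[j][l]` on `z`. [folklore] -/
structure K1Rec where
  /-- the pair weight of the class -/
  m : ℕ
  /-- the representative direction (row lists) -/
  z : List (List ℤ)
  /-- `C[j][l]` = coefficients over the weight-`m` parts of the slices -/
  C : List (List (List ℤ))
  /-- `L[j][l]` = coefficient on `z` -/
  L : List (List ℤ)

/-- Homogeneity of the integer tensor: `T_{ijl} ≠ 0 ⇒ ωA i + ωB j + ωC l = e₀`. [folklore] -/
def homogCheck (a b c : ℕ) [NeZero a] [NeZero b] [NeZero c] (T : Fin a → Fin b → Fin c → ℤ)
    (wA wB wC : List ℕ) (e0 : ℕ) : Bool :=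
  (List.range a).all fun i => (List.range b).all fun j => (List.range c).all fun l =>
    (T (finCode a i) (finCode b j) (finCode c l) == 0) || (nget wA i + nget wB j + nget wC l == e0)

/-- The identity `D · E_{jl} = ∑_i C[j][l][i] · (T_i)^{(m)} + L[j][l] · z` checked on the pairs
`(j', l')` of weight `m` (on the other pairs both sides vanish by construction). [folklore] -/
def idCheck (a b c : ℕ) [NeZero a] [NeZero b] [NeZero c] (T : Fin a → Fin b → Fin c → ℤ)
    (wB wC : List ℕ) (m : ℕ) (D : ℤ) (C : List (List (List ℤ))) (L z : List (List ℤ)) (j l : ℕ) :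
    Bool :=
  (List.range b).all fun j' => (List.range c).all fun l' =>
    (wt wB wC j' l' != m) ||
      ((if j' = j ∧ l' = l then D else 0) ==
        lsum a (fun i => mget3 C j l i * T (finCode a i) (finCode b j') (finCode c l')) +
          mget L j l * mget z j' l')

/-- Check of a `k = 0` record: the identity for every pair of weight `m` (no `z`). [folklore] -/
def k0Check (a b c : ℕ) [NeZero a] [NeZero b] [NeZero c] (T : Fin a → Fin b → Fin c → ℤ)
    (wB wC : List ℕ) (D : ℤ) (R : K0Rec) : Bool :=
  (List.range b).all fun j => (List.range c).all fun l =>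
    (wt wB wC j l != R.m) || idCheck a b c T wB wC R.m D R.C [] [] j l

/-- Check of a `k = 1` record: `z` is supported on weight `m`, and the identity for every pair of
weight `m`. [folklore] -/
def k1Check (a b c : ℕ) [NeZero a] [NeZero b] [NeZero c] (T : Fin a → Fin b → Fin c → ℤ)
    (wB wC : List ℕ) (D : ℤ) (R : K1Rec) : Bool :=
  ((List.range b).all fun j => (List.range c).all fun l =>
    (wt wB wC j l == R.m) || (mget R.z j l == 0)) &&
  (List.range b).all fun j => (List.range c).all fun l =>
    (wt wB wC j l != R.m) || idCheck a b c T wB wC R.m D R.C R.L R.z j l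

/-- Every pair weight is the weight of some record (k0, k1 or open). [folklore] -/
def coverCheck (b c : ℕ) (wB wC : List ℕ) (k0s : List K0Rec) (k1s : List K1Rec)
    (opens : List ℕ) : Bool :=
  (List.range b).all fun j => (List.range c).all fun l =>
    (k0s.any fun R => R.m == wt wB wC j l) || (k1s.any fun R => R.m == wt wB wC j l) ||
      (opens.any fun m => m == wt wB wC j l)

/-- **The weight-class certificate** of one torus node: homogeneity, coverage, and the `k = 0` /
`k = 1` identities with common denominator `D`. [cite: JagiellaJelisiejew2026Unrestrictions, Thm. 1.8] -/
def check (a b c : ℕ) [NeZero a] [NeZero b] [NeZero c] (T : Fin a → Fin b → Fin c → ℤ)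
    (wA wB wC : List ℕ) (e0 : ℕ) (D : ℤ) (k0s : List K0Rec) (k1s : List K1Rec)
    (opens : List ℕ) : Bool :=
  homogCheck a b c T wA wB wC e0 && coverCheck b c wB wC k0s k1s opens &&
    (k0s.all fun R => k0Check a b c T wB wC D R) && (k1s.all fun R => k1Check a b c T wB wC D R)

/-! ### Soundness -/

section Sound

variable {K : Type u} [Field K]

/-- Unpacking a double `List.range` loop at `(j, l)`. [folklore] -/
theorem of_all_range₂ {b c : ℕ} {P : ℕ → ℕ → Bool}
    (h : ((List.range b).all fun j => (List.range c).all fun l => P j l) = true) (j : Fin b)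
    (l : Fin c) : P j l = true := by
  rw [List.all_eq_true] at h
  have h1 := h j (List.mem_range.2 j.isLt)
  rw [List.all_eq_true] at h1
  exact h1 l (List.mem_range.2 l.isLt)

/-- The elementary matrix `E_{jl}`. [folklore] -/
def stdMat {b c : ℕ} (j : Fin b) (l : Fin c) : Fin b → Fin c → K :=
  fun j' l' => if j' = j ∧ l' = l then 1 else 0

/-- `Z = ∑_{j,l} Z_{jl} E_{jl}`. [folklore] -/
theorem eq_sum_smul_stdMat {b c : ℕ} (Z : Fin b → Fin c → K) :
    Z = ∑ j, ∑ l, Z j l • (stdMat j l : Fin b → Fin c → K) := by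
  funext j' l'
  rw [Finset.sum_apply, Finset.sum_apply, Finset.sum_eq_single j']
  · rw [Finset.sum_apply, Finset.sum_apply, Finset.sum_eq_single l']
    · simp [stdMat]
    · intro l _ hl
      simp [stdMat, Ne.symm hl]
    · intro h; exact absurd (Finset.mem_univ _) h
  · intro j _ hj
    rw [Finset.sum_apply, Finset.sum_apply]
    exact Finset.sum_eq_zero fun l _ => by simp [stdMat, Ne.symm hj]
  · intro h; exact absurd (Finset.mem_univ _) h

/-- Homogeneity of `T ⊗ K` from `homogCheck`. [folklore] -/
theorem hom_of_homogCheck {a b c : ℕ} [NeZero a] [NeZero b] [NeZero c]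
    {T : Fin a → Fin b → Fin c → ℤ} {wA wB wC : List ℕ} {e0 : ℕ}
    (h : homogCheck a b c T wA wB wC e0 = true) :
    ∀ (i : Fin a) (j : Fin b) (l : Fin c), ((T i j l : ℤ) : K) ≠ 0 →
      (fun i : Fin a => nget wA i) i + (fun j : Fin b => nget wB j) j +
        (fun l : Fin c => nget wC l) l = e0 := by
  intro i j l hne
  unfold homogCheck at h
  rw [List.all_eq_true] at h
  have h1 := h i (List.mem_range.2 i.isLt)
  have h2 := of_all_range₂ h1 j l
  rw [finCode_of_lt i.isLt, finCode_of_lt j.isLt, finCode_of_lt l.isLt] at h2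
  simp only [Bool.or_eq_true, beq_iff_eq] at h2
  rcases h2 with h0 | hw
  · exact absurd (by rw [h0, Int.cast_zero]) hne
  · exact hw

/-- **The class reduction.** If the identities of a record of weight `m` hold
(`idCheck` for every pair of weight `m`, `z` supported on weight `m`), then every `Z` homogeneous
of weight `m` is `λ • z + v` with `v ∈ T(A^*)`. [cite: JagiellaJelisiejew2026Unrestrictions, Thm. 1.8] -/
theorem exists_eq_smul_add_of_idCheck {a b c : ℕ} [NeZero a] [NeZero b] [NeZero c]
    {T : Fin a → Fin b → Fin c → ℤ} {wA wB wC : List ℕ} {e0 : ℕ}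
    (hhom : homogCheck a b c T wA wB wC e0 = true) {m : ℕ} {D : ℤ} (hD : (D : K) ≠ 0)
    {C : List (List (List ℤ))} {L z : List (List ℤ)}
    (hz : ∀ (j : Fin b) (l : Fin c), wt wB wC j l ≠ m → mget z j l = 0)
    (hid : ∀ (j : Fin b) (l : Fin c), wt wB wC j l = m → idCheck a b c T wB wC m D C L z j l = true)
    (Z : Fin b → Fin c → K) (hZ : ∀ j l, Z j l ≠ 0 → nget wB j + nget wC l = m) :
    ∃ (lam : K) (v : Fin b → Fin c → K), v ∈ sliceSpan (fun i j l => ((T i j l : ℤ) : K)) ∧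
      Z = lam • (fun (j : Fin b) (l : Fin c) => ((mget z j l : ℤ) : K)) + v := by
  classical
  set tK : Fin a → Fin b → Fin c → K := fun i j l => ((T i j l : ℤ) : K) with htK
  set zK : Fin b → Fin c → K := fun j l => ((mget z j l : ℤ) : K) with hzK
  let ωB : Fin b → ℕ := fun j => nget wB j
  let ωC : Fin c → ℕ := fun l => nget wC l
  have hhomK := hom_of_homogCheck (K := K) hhom
  -- the vectors `v_{jl} := D • E_{jl} - L_{jl} • z`
  let vv : Fin b → Fin c → (Fin b → Fin c → K) := fun j l =>
    (D : K) • (stdMat j l : Fin b → Fin c → K) - ((mget L j l : ℤ) : K) • zK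
  have hvV : ∀ (j : Fin b) (l : Fin c), wt wB wC j l = m → vv j l ∈ sliceSpan tK := by
    intro j l hjl
    have hI := hid j l hjl
    have heq : vv j l = ∑ i : Fin a, ((mget3 C j l i : ℤ) : K) • weightPart ωB ωC m (tK i) := by
      funext j' l'
      simp only [vv, Pi.sub_apply, Pi.smul_apply, smul_eq_mul, Finset.sum_apply, weightPart_apply,
        stdMat]
      by_cases hw : ωB j' + ωC l' = m
      · -- the checked integer identity at `(j', l')`
        have h2 := of_all_range₂ (P := fun j' l' => (wt wB wC j' l' != m) ||
            ((if j' = (j : ℕ) ∧ l' = (l : ℕ) then D else 0) ==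
              lsum a (fun i => mget3 C j l i * T (finCode a i) (finCode b j') (finCode c l')) +
                mget L j l * mget z j' l')) hI j' l'
        have hw' : wt wB wC j' l' = m := hw
        simp only [hw', bne_self_eq_false, Bool.false_or, beq_iff_eq, lsum_eq,
          finCode_of_lt j'.isLt, finCode_of_lt l'.isLt] at h2
        have hf : ∀ i : Fin a, finCode a (i : ℕ) = i := fun i => Fin.ext (Nat.mod_eq_of_lt i.isLt)
        simp only [hf] at h2
        have h3 := congrArg (Int.cast : ℤ → K) h2
        simp only [Int.cast_add, Int.cast_mul, Int.cast_sum, apply_ite (Int.cast : ℤ → K),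
          Int.cast_zero] at h3
        simp only [if_pos hw, Fin.ext_iff]
        rw [show (if (j' : ℕ) = j ∧ (l' : ℕ) = l then (D : K) else 0) =
          (D : K) * (if (j' : ℕ) = j ∧ (l' : ℕ) = l then 1 else 0) by split_ifs <;> simp] at h3
        rw [htK, hzK]
        linear_combination h3
      · have hne : ¬ (j' = j ∧ l' = l) := by
          rintro ⟨rfl, rfl⟩; exact hw hjl
        have hz0 : zK j' l' = 0 := by
          simp only [hzK, hz j' l' hw, Int.cast_zero]
        simp [if_neg hne, if_neg hw, hz0]
    rw [heq]
    exact Submodule.sum_mem _ fun i _ =>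
      Submodule.smul_mem _ _ (weightPart_mem_sliceSpan hhomK m (Submodule.subset_span ⟨i, rfl⟩))
  -- `D • Z - l₀ • z = ∑ Z_{jl} • v_{jl} ∈ T(A^*)`
  let l₀ : K := ∑ j, ∑ l, Z j l * ((mget L j l : ℤ) : K)
  have hsum : (D : K) • Z - l₀ • zK = ∑ j, ∑ l, Z j l • vv j l := by
    have hE := eq_sum_smul_stdMat Z
    simp only [vv, smul_sub, Finset.sum_sub_distrib, smul_smul]
    rw [Finset.sum_smul]
    simp_rw [Finset.sum_smul]
    congr 1
    conv_lhs => rw [hE]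
    rw [Finset.smul_sum]
    refine Finset.sum_congr rfl fun j _ => ?_
    rw [Finset.smul_sum]
    refine Finset.sum_congr rfl fun l _ => ?_
    rw [smul_smul, mul_comm]
  have hmem : (D : K) • Z - l₀ • zK ∈ sliceSpan tK := by
    rw [hsum]
    refine Submodule.sum_mem _ fun j _ => Submodule.sum_mem _ fun l _ => ?_
    by_cases hw : wt wB wC j l = m
    · exact Submodule.smul_mem _ _ (hvV j l hw)
    · have hZ0 : Z j l = 0 := by
        by_contra hne; exact hw (hZ j l hne)
      rw [hZ0, zero_smul]; exact Submodule.zero_mem _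
  refine ⟨(D : K)⁻¹ * l₀, (D : K)⁻¹ • ((D : K) • Z - l₀ • zK), Submodule.smul_mem _ _ hmem, ?_⟩
  rw [smul_sub, smul_smul, smul_smul, inv_mul_cancel₀ hD, one_smul]
  abel

/-- **Soundness of the weight-class certificate.**  If `check` passes with `(D : K) ≠ 0`,
`a < r ≤ bR(T ⊗ K)`, every `k = 1` child `T + e_new ⊗ z` has `bR > r`, and every open class is
refuted (`∀ Z` homogeneous of that weight, `Z ∉ T(A^*) → bR(T + e_new ⊗ Z) > r`), then
`bR(T ⊗ K) > r`. [cite: JagiellaJelisiejew2026Unrestrictions, Thm. 1.8] -/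
theorem lt_algBorderRank_of_check (K : Type u) [Field K] {a b c r : ℕ} [NeZero a] [NeZero b]
    [NeZero c] (T : Fin a → Fin b → Fin c → ℤ) {wA wB wC : List ℕ} {e0 : ℕ} {D : ℤ}
    {k0s : List K0Rec} {k1s : List K1Rec} {opens : List ℕ}
    (h : check a b c T wA wB wC e0 D k0s k1s opens = true) (hD : (D : K) ≠ 0) (har : a < r)
    (hr : r ≤ algBorderRank (fun i j l => ((T i j l : ℤ) : K)))
    (hk1 : ∀ R ∈ k1s, r < algBorderRank (fun i j l => ((extendInt T R.z i j l : ℤ) : K)))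
    (hopen : ∀ m ∈ opens, ∀ Z : Fin b → Fin c → K, (∀ j l, Z j l ≠ 0 → nget wB j + nget wC l = m) →
      Z ∉ sliceSpan (fun i j l => ((T i j l : ℤ) : K)) →
      r < algBorderRank (extendSlice (fun i j l => ((T i j l : ℤ) : K)) Z)) :
    r < algBorderRank (fun i j l => ((T i j l : ℤ) : K)) := by
  classical
  unfold check at h
  simp only [Bool.and_eq_true] at h
  obtain ⟨⟨⟨hhom, hcov⟩, hk0⟩, hk1c⟩ := h
  set tK : Fin a → Fin b → Fin c → K := fun i j l => ((T i j l : ℤ) : K) with htK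
  have hhomK := hom_of_homogCheck (K := K) hhom
  refine lt_algBorderRank_of_card_lt_of_forall_weight_extendSlice tK hhomK (by simpa using har) hr
    fun m Z hZm hZV => ?_
  -- `Z ≠ 0`: pick a pair of weight `m`
  have hZne : ∃ j l, Z j l ≠ 0 := by
    by_contra hall
    push Not at hall
    apply hZV
    have : Z = 0 := funext fun j => funext fun l => hall j l
    rw [this]; exact Submodule.zero_mem _
  obtain ⟨j₀, l₀, hj₀⟩ := hZne
  have hm₀ : wt wB wC j₀ l₀ = m := hZm j₀ l₀ hj₀
  have hc := of_all_range₂ hcov j₀ l₀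
  simp only [Bool.or_eq_true, List.any_eq_true, beq_iff_eq, hm₀] at hc
  rcases hc with (⟨R, hR, hRm⟩ | ⟨R, hR, hRm⟩) | ⟨m', hm', rfl⟩
  · -- k = 0: `Z ∈ T(A^*)`, contradiction
    exfalso
    rw [List.all_eq_true] at hk0
    have hRc := hk0 R hR
    unfold k0Check at hRc
    obtain ⟨lam, v, hv, hZ⟩ := exists_eq_smul_add_of_idCheck (K := K) hhom hD (C := R.C) (L := [])
      (z := []) (m := R.m) (fun j l _ => by simp [mget]) (fun j l hjl => by
        have := of_all_range₂ hRc j l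
        simp only [Bool.or_eq_true, bne_iff_ne, ne_eq, hjl, not_true_eq_false, false_or] at this
        exact this) Z (by rw [hRm]; exact hZm)
    apply hZV
    have hz0 : (fun j l => ((mget ([] : List (List ℤ)) (j : Fin b) (l : Fin c) : ℤ) : K)) = 0 := by
      funext j l; simp [mget]
    rw [hZ, hz0, smul_zero, zero_add]
    exact hv
  · -- k = 1: `Z = λ z + v`
    rw [List.all_eq_true] at hk1c
    have hRc := hk1c R hR
    unfold k1Check at hRc
    simp only [Bool.and_eq_true] at hRc
    obtain ⟨hzs, hids⟩ := hRc
    obtain ⟨lam, v, hv, hZ⟩ := exists_eq_smul_add_of_idCheck (K := K) hhom hD (C := R.C) (L := R.L)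
      (z := R.z) (m := R.m) (fun j l hjl => by
        have := of_all_range₂ hzs j l
        simp only [Bool.or_eq_true, beq_iff_eq, hjl, false_or] at this
        exact this) (fun j l hjl => by
        have := of_all_range₂ hids j l
        simp only [Bool.or_eq_true, bne_iff_ne, ne_eq, hjl, not_true_eq_false, false_or] at this
        exact this) Z (by rw [hRm]; exact hZm)
    obtain ⟨cf, hcf⟩ := (Submodule.mem_span_range_iff_exists_fun K).1 hv
    have hz : r < algBorderRank (extendSlice tK fun j l => ((mget R.z j l : ℤ) : K)) :=
      (hk1 R hR).trans_le (algBorderRank_extendInt_le T R.z)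
    exact lt_algBorderRank_extendSlice_of_eq_smul_add tK hz (l := lam) (c := cf)
      (by rw [hZ, hcf]) hZV
  · exact hopen m' hm' Z hZm hZV

end Sound

end TorusCert

end Literature.Computability.AlgebraicComplexity
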